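import Summits.ResolutionOfSingularities.ResolutionOfSingularities.Theorems.HilbertSamuelEliminationSigmaMaxModificationsCorridor3SigmaMenuDiscipline
import Summits.ResolutionOfSingularities.ResolutionOfSingularities.Theorems.HilbertSamuelEliminationSigmaMaxModificationsCorridor3SigmaMenuPlus
import HarnessLib

/-!
# [OURS · L1 W4.2] σ-LAYER — `Corridor3SigmaMenuStrategy`: the menu-disciplined type INSTANTIATED — the PLUS menu of record (RULINGS v3.14-13 (DB)/(DA),
# v3.14-14 (DP)) and the basic boundary sub-menu — on GOOD scopes: `StrategyE.IsMenuDisciplined`, admissibility by res-type-067's lemmas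

Crux chain w42 (`SigmaMaxModifications`, stmt-ResolutionOfSingularities-18506; conjunct `SigmaMaxModificationsCorridor3`, stmt-ResolutionOfSingularities-19249),
σ-layer / ELIMINATION LINE (E2)+(E2′). Typer res-L1-type-o1 (OURS typer G4) over `…Corridor3SigmaMenuDiscipline` (this typer, p526241: `CentreMenu`,
`IsDisciplinedBy[Over]`, `MenuClauseA`, `StrategyE.hybrid`, `isAdmissibleStrategyOnE_hybrid`) and res-type-067's `…Corridor3SigmaMenuDefs` (p525499: `IsMenuCentreAt`,
`menuCentre`, `IsMenuCentreAt.admissibleClause`) / `…Corridor3SigmaMenuPlus` (`IntrinsicMenuPlusAt`, `isPermissible_menuCentre_of_mem_plus`,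
`subset_hsStratum_of_mem_intrinsicMenuPlusAt`, `mem_of_mem_intrinsicMenuPlusAt`, `intrinsicMenuAt_subset_plus`). OURS (cell res-hironaka, slot W4.2); NOT
statements of H. Hironaka's manuscript [Hironaka2017] nor of [CossartJannsenSaito2020]; AI-typed, weaker than expert review. Helper VOCABULARY
`--supports stmt-ResolutionOfSingularities-19249 --as helper` (counted 0). Definitions + proved glue; NO row is claimed.

## Contents (namespace `…Theorems.SigmaMaxModificationsCorridor3.Sigma`)

* `basicMenu : CentreMenu` := 067's `IsMenuCentreAt` (boundary sub-menu); **`plusMenu : CentreMenu`** := «`C = menuCentre Z` for a member `Z` of 067's WIDER menu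
  `IntrinsicMenuPlusAt E N ν x`, AND `C.subscheme` regular» — the Plus twin of `IsMenuCentreAt` in `CentreMenu` form (067's `…MenuPlus` types the menu and its
  permissibility lemma; if 067 later names an `IsMenuCentrePlusAt` with this body the two agree by `Iff.rfl`); `basicMenu_le_plusMenu`.
* `StateScopeGood N ν 𝒮` — every state of the scope sits on a REDUCED, EXCELLENT stage of dimension `≤ N` with CLOSED `ν`-stratum (what the cell's cycle
  invariant supplies along runs from maximal origins); `StateScopeGood.mono`.
* `menuClauseA_basic`, **`menuClauseA_plus`** : `StateScopeGood N ν 𝒮 → ν ≠ Φ^{(N)} → MenuClauseA _ N ν 𝒮` — BY NAME from 067's permissibility lemmas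
  (`IsMenuCentreAt.admissibleClause`, `isPermissible_menuCentre_of_mem_plus` + the member lemmas).
* **`StrategyE.IsMenuDisciplined N ν σ := σ.IsDisciplinedBy plusMenu N ν`** — THE TYPE OF RECORD for the scheme-side oracle ω_ρ (RULING (DA): centre ∈
  `IntrinsicMenuPlusAt` ∧ regular), `StrategyE.IsMenuDisciplinedOver N ν τ σ` (hybrid over a fallback), `IsDisciplinedBy.basic_to_plus`; the plugs
  `isAdmissibleStrategyOnE_of_menuDisciplined[Over]` and **`isAdmissibleStrategyOnE_hybrid_plus`** (ANY `plusMenu`-disciplined policy π over a fallback τ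
  with admissible total steps is admissible on every good scope — the socket for (CX)'s `exists_cornerOracle_of_initialSolvable` read scheme-side).
-/

noncomputable section

set_option linter.dupNamespace false

open CategoryTheory AlgebraicGeometry TopologicalSpace
open Summit.ResolutionOfSingularities.ResolutionOfSingularities.Theorems.CampaignW42
open Literature.AlgebraicGeometry.Resolution Literature.RingTheory.HilbertSamuel

namespace Summit.ResolutionOfSingularities.ResolutionOfSingularities.Theorems.SigmaMaxModificationsCorridor3.Sigma

universe u

/-! ## §1. The two menus as `CentreMenu`s -/

/-- [OURS · L1 W4.2] **THE BASIC (boundary sub-) MENU as a `CentreMenu`**: res-type-067's `IsMenuCentreAt` (RULINGS (CS)). [folklore] -/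
def basicMenu : CentreMenu.{u} :=
  fun W E N ν x C => IsMenuCentreAt (W := W) E N ν x C

/-- Unfolding (`Iff.rfl`). [folklore] -/
@[simp] theorem basicMenu_iff {W : Scheme.{u}} (E : Boundary W) (N : ℕ) (ν : ℕ → ℕ) (x : W) (C : W.IdealSheafData) :
    basicMenu W E N ν x C ↔ IsMenuCentreAt E N ν x C :=
  Iff.rfl

/-- [OURS · L1 W4.2] **THE PLUS MENU OF RECORD as a `CentreMenu`** (RULING v3.14-13 (DB): the oracle reads the WIDER menu): `C` is the reduced structure
`menuCentre Z` on a member `Z` of res-type-067's `IntrinsicMenuPlusAt E N ν x` (the point; components through `x` of `(⋂ S_i) ∩ X(ν) ∩ ⋂ V(E_k)` for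
stratum components `S_i ∋ x` and boundary members `E_k ∋ x`), AND `C.subscheme` is REGULAR (regularity is part of the datum, as in `IsMenuCentreAt`).
NOT a statement of the manuscript. [folklore] -/
def plusMenu : CentreMenu.{u} :=
  fun W E N ν x C => (∃ Z : Closeds W, (Z : Set W) ∈ IntrinsicMenuPlusAt E N ν x ∧ C = menuCentre Z) ∧ Scheme.IsRegular C.subscheme

/-- Unfolding (`Iff.rfl`). [folklore] -/
theorem plusMenu_iff {W : Scheme.{u}} (E : Boundary W) (N : ℕ) (ν : ℕ → ℕ) (x : W) (C : W.IdealSheafData) :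
    plusMenu W E N ν x C ↔ (∃ Z : Closeds W, (Z : Set W) ∈ IntrinsicMenuPlusAt E N ν x ∧ C = menuCentre Z) ∧ Scheme.IsRegular C.subscheme :=
  Iff.rfl

/-- The basic menu is contained in the Plus menu (067's `intrinsicMenuAt_subset_plus`). [folklore] -/
theorem basicMenu_le_plusMenu {W : Scheme.{u}} {E : Boundary W} {N : ℕ} {ν : ℕ → ℕ} {x : W} {C : W.IdealSheafData}
    (h : basicMenu W E N ν x C) : plusMenu W E N ν x C := by
  obtain ⟨⟨Z, hZ, hC⟩, hreg⟩ := h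
  exact ⟨⟨Z, intrinsicMenuAt_subset_plus E N ν x hZ, hC⟩, hreg⟩

/-- A Plus-menu centre passes through its point. [folklore] -/
theorem plusMenu.mem_support {W : Scheme.{u}} {E : Boundary W} {N : ℕ} {ν : ℕ → ℕ} {x : W} {C : W.IdealSheafData}
    (h : plusMenu W E N ν x C) : x ∈ (C.support : Set W) := by
  obtain ⟨⟨Z, hZ, rfl⟩, -⟩ := h
  rw [coe_support_menuCentre]
  exact mem_of_mem_intrinsicMenuPlusAt hZ

/-- A Plus-menu centre lies in the `ν`-stratum (`x ∈ X(ν)`, `X(ν)` closed). [folklore] -/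
theorem plusMenu.support_subset_hsStratum {W : Scheme.{u}} {E : Boundary W} {N : ℕ} {ν : ℕ → ℕ} {x : W} {C : W.IdealSheafData}
    (h : plusMenu W E N ν x C) (hY : IsClosed (Scheme.hsStratum W N ν)) (hx : x ∈ Scheme.hsStratum W N ν) :
    (C.support : Set W) ⊆ Scheme.hsStratum W N ν := by
  obtain ⟨⟨Z, hZ, rfl⟩, -⟩ := h
  rw [coe_support_menuCentre]
  exact subset_hsStratum_of_mem_intrinsicMenuPlusAt hY hx hZ

/-- **A Plus-menu centre is permissible** on a reduced excellent stage of dimension `≤ N` with closed `ν`-stratum, `ν ≠ Φ^{(N)}` (067's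
`isPermissible_menuCentre_of_mem_plus`). [cite: CossartJannsenSaito2020, Def. 3.1 (2), Thm. 3.3] -/
theorem plusMenu.isPermissible {W : Scheme.{u}} [IsLocallyNoetherian W] [IsReduced W] (hexc : Scheme.IsExcellent W) {N : ℕ}
    (hdim : topologicalKrullDim W ≤ (N : WithBot ℕ∞)) {ν : ℕ → ℕ} (hν : ν ≠ iterPSum N Phi) {E : Boundary W} {x : W}
    (hY : IsClosed (Scheme.hsStratum W N ν)) (hx : x ∈ Scheme.hsStratum W N ν) {C : W.IdealSheafData} (h : plusMenu W E N ν x C) :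
    IdealSheafData.IsPermissible C := by
  obtain ⟨⟨Z, hZ, rfl⟩, hreg⟩ := h
  exact isPermissible_menuCentre_of_mem_plus hexc hdim hν hY hx hZ hreg

/-! ## §2. Good scopes and clause (a) for both menus -/

/-- [OURS · L1 W4.2] **A GOOD STATE SCOPE**: every state `(W, L, P, E)` in `𝒮` sits on a REDUCED, EXCELLENT stage of dimension `≤ N` whose `ν`-stratum is
CLOSED — the hypotheses of 067's permissibility lemmas; supplied along runs from maximal origins by the cell's cycle invariant (`Moving.CycleInv.isExcellent`,
`.isClosed_hsStratum`, …). NOT a statement of the manuscript. [folklore] -/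
def StateScopeGood (N : ℕ) (ν : ℕ → ℕ) (𝒮 : StateScopeE.{u}) : Prop :=
  ∀ (W : Scheme.{u}) (hW : IsLocallyNoetherian W) (L : Labelling W) (P : Option (Pending W)) (E : Boundary W), 𝒮 W hW L P E →
    IsReduced W ∧ Scheme.IsExcellent W ∧ topologicalKrullDim W ≤ (N : WithBot ℕ∞) ∧ IsClosed (Scheme.hsStratum W N ν)

variable {N : ℕ} {ν : ℕ → ℕ} {𝒮 𝒯 : StateScopeE.{u}} {π τ σ : StrategyE.{u}}

/-- Good scopes are closed under shrinking. [folklore] -/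
theorem StateScopeGood.mono (h : StateScopeGood N ν 𝒮) (h𝒯 : ∀ W hW L P E, 𝒯 W hW L P E → 𝒮 W hW L P E) : StateScopeGood N ν 𝒯 :=
  fun W hW L P E hT => h W hW L P E (h𝒯 W hW L P E hT)

/-- **The BASIC menu satisfies clause (a) on good scopes** (`ν ≠ Φ^{(N)}`), by 067's `IsMenuCentreAt.admissibleClause`. [cite: CossartJannsenSaito2020, Def. 3.1, Thm. 3.3] -/
theorem menuClauseA_basic (h𝒮 : StateScopeGood N ν 𝒮) (hν : ν ≠ iterPSum N Phi) : MenuClauseA basicMenu N ν 𝒮 := by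
  intro W hW L P E hS x hx C hC
  haveI : IsLocallyNoetherian W := hW
  obtain ⟨hred, hexc, hdim, hY⟩ := h𝒮 W hW L P E hS
  haveI : IsReduced W := hred
  exact IsMenuCentreAt.admissibleClause hexc hdim hν hY hx hC

/-- **The PLUS menu satisfies clause (a) on good scopes** (`ν ≠ Φ^{(N)}`): permissible (067's `isPermissible_menuCentre_of_mem_plus`), inside `X(ν)`, non-empty
(it contains its point). [cite: CossartJannsenSaito2020, Def. 3.1, Thm. 3.3] -/
theorem menuClauseA_plus (h𝒮 : StateScopeGood N ν 𝒮) (hν : ν ≠ iterPSum N Phi) : MenuClauseA plusMenu N ν 𝒮 := by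
  intro W hW L P E hS x hx C hC
  haveI : IsLocallyNoetherian W := hW
  obtain ⟨hred, hexc, hdim, hY⟩ := h𝒮 W hW L P E hS
  haveI : IsReduced W := hred
  exact ⟨plusMenu.isPermissible hexc hdim hν hY hx hC, plusMenu.support_subset_hsStratum hC hY hx, fun _ => ⟨x, plusMenu.mem_support hC⟩⟩

/-! ## §3. The TYPE OF RECORD: menu-disciplined = disciplined by the Plus menu -/

/-- [OURS · L1 W4.2] **MENU-DISCIPLINED** (THE TYPE RULINGS (CT)/(DA)/(DB)/(DP) ask the scheme-side ω_ρ to inhabit): every step has as centre a REGULAR member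
of the PLUS menu at a point of the `ν`-stratum. [folklore] -/
def StrategyE.IsMenuDisciplined (N : ℕ) (ν : ℕ → ℕ) (σ : StrategyE.{u}) : Prop :=
  σ.IsDisciplinedBy plusMenu N ν

/-- [OURS · L1 W4.2] **MENU-DISCIPLINED OVER A FALLBACK** (hybrid shape, Plus menu). [folklore] -/
def StrategyE.IsMenuDisciplinedOver (N : ℕ) (ν : ℕ → ℕ) (τ σ : StrategyE.{u}) : Prop :=
  StrategyE.IsDisciplinedByOver plusMenu N ν τ σ

/-- Basic-menu discipline implies menu discipline (Plus is wider). [folklore] -/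
theorem StrategyE.IsDisciplinedBy.basic_to_plus (h : σ.IsDisciplinedBy basicMenu N ν) : σ.IsMenuDisciplined N ν :=
  h.mono fun _ _ _ _ hC => basicMenu_le_plusMenu hC

/-- The hybrid of a menu-disciplined policy is menu-disciplined over its fallback. [folklore] -/
theorem StrategyE.IsMenuDisciplined.hybrid (h : π.IsMenuDisciplined N ν) (τ : StrategyE.{u}) :
    StrategyE.IsMenuDisciplinedOver N ν τ (π.hybrid τ) :=
  StrategyE.IsDisciplinedBy.hybrid h τ

/-- **A menu-disciplined strategy, total on a good scope, is admissible there** (`ν ≠ Φ^{(N)}`). [cite: CossartJannsenSaito2020, Def. 3.1, Rem. 6.29 (1)] -/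
theorem isAdmissibleStrategyOnE_of_menuDisciplined (hσ : σ.IsMenuDisciplined N ν) (h𝒮 : StateScopeGood N ν 𝒮) (hν : ν ≠ iterPSum N Phi)
    (htotal : ∀ (W : Scheme.{u}) (hW : IsLocallyNoetherian W) (L : Labelling W) (P : Option (Pending W)) (E : Boundary W), 𝒮 W hW L P E →
      (Scheme.hsStratum W N ν).Nonempty → ∃ (C : W.IdealSheafData) (P' : Option (Pending (blowup C))), σ.step W hW N ν L P E C P') :
    IsAdmissibleStrategyOnE 𝒮 N ν σ :=
  isAdmissibleStrategyOnE_of_disciplinedBy hσ (menuClauseA_plus h𝒮 hν) htotal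

/-- **A hybrid (menu-disciplined over a fallback with admissible steps), total on a good scope, is admissible there** (`ν ≠ Φ^{(N)}`).
[cite: CossartJannsenSaito2020, Def. 3.1, Rem. 6.29 (1)] -/
theorem isAdmissibleStrategyOnE_of_menuDisciplinedOver (hσ : StrategyE.IsMenuDisciplinedOver N ν τ σ) (h𝒮 : StateScopeGood N ν 𝒮)
    (hν : ν ≠ iterPSum N Phi)
    (hτ : ∀ (W : Scheme.{u}) (hW : IsLocallyNoetherian W) (L : Labelling W) (P : Option (Pending W)) (E : Boundary W), 𝒮 W hW L P E →
      ∀ (C : W.IdealSheafData) (P' : Option (Pending (blowup C))), τ.step W hW N ν L P E C P' →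
        IdealSheafData.IsPermissible C ∧ (C.support : Set W) ⊆ Scheme.hsStratum W N ν ∧
          ((Scheme.hsStratum W N ν).Nonempty → (C.support : Set W).Nonempty))
    (htotal : ∀ (W : Scheme.{u}) (hW : IsLocallyNoetherian W) (L : Labelling W) (P : Option (Pending W)) (E : Boundary W), 𝒮 W hW L P E →
      (Scheme.hsStratum W N ν).Nonempty → ∃ (C : W.IdealSheafData) (P' : Option (Pending (blowup C))), σ.step W hW N ν L P E C P') :
    IsAdmissibleStrategyOnE 𝒮 N ν σ :=
  isAdmissibleStrategyOnE_of_disciplinedByOver hσ (menuClauseA_plus h𝒮 hν) hτ htotal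

/-- **THE PLUG OF RECORD (RULING (DA))**: the hybrid `π.hybrid τ` of ANY menu-disciplined policy `π` (e.g. a corner policy reading the Plus menu — (CX)'s
`exists_cornerOracle_of_initialSolvable` read scheme-side) over a fallback `τ` whose steps satisfy clause (a) and which is TOTAL on a good scope, is ADMISSIBLE on
that scope (`ν ≠ Φ^{(N)}`); it is moreover FUNCTIONAL when `π` and `τ` are (`StrategyE.IsFunctional.hybrid`). [cite: CossartJannsenSaito2020, Def. 3.1, Rem. 6.29 (1)] -/
theorem isAdmissibleStrategyOnE_hybrid_plus (hπ : π.IsMenuDisciplined N ν) (h𝒮 : StateScopeGood N ν 𝒮) (hν : ν ≠ iterPSum N Phi)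
    (hτa : ∀ (W : Scheme.{u}) (hW : IsLocallyNoetherian W) (L : Labelling W) (P : Option (Pending W)) (E : Boundary W), 𝒮 W hW L P E →
      ∀ (C : W.IdealSheafData) (P' : Option (Pending (blowup C))), τ.step W hW N ν L P E C P' →
        IdealSheafData.IsPermissible C ∧ (C.support : Set W) ⊆ Scheme.hsStratum W N ν ∧
          ((Scheme.hsStratum W N ν).Nonempty → (C.support : Set W).Nonempty))
    (hτt : ∀ (W : Scheme.{u}) (hW : IsLocallyNoetherian W) (L : Labelling W) (P : Option (Pending W)) (E : Boundary W), 𝒮 W hW L P E →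
      (Scheme.hsStratum W N ν).Nonempty → ∃ (C : W.IdealSheafData) (P' : Option (Pending (blowup C))), τ.step W hW N ν L P E C P') :
    IsAdmissibleStrategyOnE 𝒮 N ν (π.hybrid τ) :=
  isAdmissibleStrategyOnE_hybrid hπ (menuClauseA_plus h𝒮 hν) hτa hτt

/-- The same plug for a basic-menu policy. [cite: CossartJannsenSaito2020, Def. 3.1, Rem. 6.29 (1)] -/
theorem isAdmissibleStrategyOnE_hybrid_basic (hπ : π.IsDisciplinedBy basicMenu N ν) (h𝒮 : StateScopeGood N ν 𝒮) (hν : ν ≠ iterPSum N Phi)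
    (hτa : ∀ (W : Scheme.{u}) (hW : IsLocallyNoetherian W) (L : Labelling W) (P : Option (Pending W)) (E : Boundary W), 𝒮 W hW L P E →
      ∀ (C : W.IdealSheafData) (P' : Option (Pending (blowup C))), τ.step W hW N ν L P E C P' →
        IdealSheafData.IsPermissible C ∧ (C.support : Set W) ⊆ Scheme.hsStratum W N ν ∧
          ((Scheme.hsStratum W N ν).Nonempty → (C.support : Set W).Nonempty))
    (hτt : ∀ (W : Scheme.{u}) (hW : IsLocallyNoetherian W) (L : Labelling W) (P : Option (Pending W)) (E : Boundary W), 𝒮 W hW L P E →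
      (Scheme.hsStratum W N ν).Nonempty → ∃ (C : W.IdealSheafData) (P' : Option (Pending (blowup C))), τ.step W hW N ν L P E C P') :
    IsAdmissibleStrategyOnE 𝒮 N ν (π.hybrid τ) :=
  isAdmissibleStrategyOnE_hybrid_plus hπ.basic_to_plus h𝒮 hν hτa hτt

end Summit.ResolutionOfSingularities.ResolutionOfSingularities.Theorems.SigmaMaxModificationsCorridor3.Sigma

end
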